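import Summits.AtomisticToContinuum.Crystallization.Theorems.ReggeStarCoercivityDefectFreeCrystallizesSiteColumnLJ
import Summits.AtomisticToContinuum.Crystallization.Theorems.PalmUnimodularRigidityLayeredLawsSelectHcpUniqueMinimiser
import Summits.AtomisticToContinuum.Crystallization.Theorems.PalmUnimodularRigidityLayeredLawsSelectHcpMinimiserEnclosure
import Summits.AtomisticToContinuum.Crystallization.Theorems.PalmUnimodularRigidityLayeredLawsSelectHcpSelectionWord
import Summits.AtomisticToContinuum.Crystallization.Theorems.PalmUnimodularRigidityCruxesToPalmRigidity
import Literature.MathematicalPhysics.StatisticalMechanics.MuGSC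
import Literature.Probability.Process.PointStationaryLaw

/-!
# Selection at exact geometry (stub `stub_exactSelectionLaw`, X3 of line `palm-good-law`, crux
# `ReggeStarCoercivity.DefectFreeCrystallizes`, stmt-AtomisticToContinuum-13603), `MuGSC` import cone

Second landing of X3 (anchor `stub_exactSelectionLawB`, the statement of `stub_exactSelectionLaw`):
the first landing (`…ExactSelectionLaw`) imports `…FarPasteLattice`, whose closure declares
`UniformlyDiscrete` a second time (`MuGroundStateConfiguration`) and so cannot sit next to the line's
glue (`MuGSC`); here the lattice sum is re-derived on the `MuGSC` side
(`UniformlyDiscrete.summable_lennardJones`).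

For the relaxed hcp reference `(a₀, h₀)` (box + global minimality of `hcpE`), a point-stationary
probability law `P` on rooted `δ`-hard-core configurations of `ℝ³`, a.s. the counting measure of a
rotated EXACT Barlow stacking `A '' barlowStacking a₀ h s` (`h ∈ {h₀, a₀ √(2/3)}`, `s` a Hägg word)
with mean root energy `≤ hcpE a₀ h₀`, is a.s. `count|(A' '' hcpStacking a₀ h₀)`.  Steps: for ANY
word the Lennard-Jones sum over the stacking seen from a point of layer `m` converges absolutely
(uniform discreteness) and is `2 · barlowSiteEnergy … m`
(`tsum_lennardJones_barlowPos_eq_two_mul_barlowSiteEnergy`), so `count|(A '' barlowStacking a h s)`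
re-rooted at the atom `A (barlowPos a h s k i j)` has root energy `barlowSiteEnergy … k`
(`rootEnergy_reroot_eq_barlowSiteEnergy`); the landed column `SiteColumnLJ.stub_siteColumnLJ` bounds
it below by `hcpE a₀ h + ½ (J₃ − J₂)(#cubic sides)`, `J₃ > J₂`, so `≤ hcpE a₀ h₀` forces `h = h₀`
and no cubic side (`selection_at_site`); the level `hcpE a₀ h₀ < 0` is not junk, so the a.s. floor
plus the mean ceiling give a.s. equality (`integrable_and_ae_eq_of_integral_le`); Aldous–Lyons
(`ae_forall_map_sub_of_ae`) moves it to every atom, whence `s = ± alternatingHagg`, the sign being a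
point reflection (`exists_eq_hcp_of_forall_siteEnergy_le`).  All `[folklore]`.
-/

noncomputable section

namespace Summit.AtomisticToContinuum.Crystallization.Theorems.PalmGoodLaw.ExactSelectionLawB

open MeasureTheory Set
open Literature.MathematicalPhysics.StatisticalMechanics Literature.Probability.Process
open Summit.AtomisticToContinuum.Crystallization.Theorems.PalmUnimodularRigidity.LayeredLawsSelectHcp
  (hcpE hcpE_eq_hcpSumS hcpSumS_pos' tube_hcpE_unique_minimiser tube_minimiserEnclosure
    eq_alternating_or_neg_of_forall bijOn_neg_hcpStacking)
open Summit.AtomisticToContinuum.Crystallization.Theorems.ExcessDecayLiouvilleCoarseGrains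
  (hcpSumS hcpPinC_dilation_value)

/-! ## The Lennard-Jones lattice sum of a Barlow stacking with an arbitrary word -/

/-- The Lennard-Jones sum over a Barlow stacking (`a, h > 0`, ANY word), seen from an arbitrary point
`x` of space, is summable in the parametrisation by `ℤ³`: the stacking is uniformly discrete, so the
sum over the point set converges (`UniformlyDiscrete.summable_lennardJones`); `barlowPos` is injective.
[folklore] -/
theorem summable_lennardJones_dist_barlowPos {a h : ℝ} (ha : 0 < a) (hh : 0 < h) (s : ℤ → ℤ)
    (x : EuclideanSpace ℝ (Fin 3)) :
    Summable fun q : ℤ × ℤ × ℤ => lennardJones (dist x (barlowPos a h s q.1 q.2.1 q.2.2)) := by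
  have hX : UniformlyDiscrete (barlowStacking a h s) :=
    ⟨min a h, lt_min ha hh, fun _ hz _ hz' hne =>
      le_dist_of_mem_barlowStacking a h s ha.le hh.le hz hz' hne⟩
  have hF : Summable fun y : ↥(barlowStacking a h s) =>
      lennardJones (dist x (y : EuclideanSpace ℝ (Fin 3))) := hX.summable_lennardJones x
  have hinj : Function.Injective fun q : ℤ × ℤ × ℤ =>
      (⟨barlowPos a h s q.1 q.2.1 q.2.2, barlowPos_mem _ _ _⟩ : ↥(barlowStacking a h s)) :=
    fun _ _ hqq' => barlowPos_injective ha hh s (congrArg Subtype.val hqq')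
  have h1 := hF.comp_injective hinj -- (elaborated apart: unifying `_ ∘ _` with the goal is slow)
  exact h1

/-- **The lattice sum seen from a point of layer `m` is `2 · barlowSiteEnergy … m`** (any word,
`a, h > 0`, any point `barlowPos a h s m i j` of the layer): by in-layer translation invariance
(reindexing by `(i', j') ↦ (i' + i, j' + j)`) the point may be taken to be the base point `(m, 0, 0)`;
the absolutely convergent sum is then organised layer by layer (`Summable.tsum_prod`), recentred at `m`
and split into the base layer (diagonal term `V_LJ(0) = 0`), the layers above and the layers below
(`tsum_of_add_one_of_neg_add_one`) — the three pieces of `barlowSiteEnergy`. [folklore] -/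
theorem tsum_lennardJones_barlowPos_eq_two_mul_barlowSiteEnergy {a h : ℝ} (ha : 0 < a) (hh : 0 < h)
    (s : ℤ → ℤ) (m i j : ℤ) :
    ∑' q : ℤ × ℤ × ℤ,
        lennardJones (dist (barlowPos a h s m i j) (barlowPos a h s q.1 q.2.1 q.2.2)) =
      2 * barlowSiteEnergy lennardJones a h s m := by
  -- adapted from `SquareWellLayerCake.StackingFaultSparsity.tsum_barlowPos_shift` and
  -- `…tsum_barlowPos_eq_two_mul_barlowSiteEnergy_of_word` (there via `MuGroundStateConfiguration`)
  have hshift : ∑' q : ℤ × ℤ × ℤ,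
        lennardJones (dist (barlowPos a h s m i j) (barlowPos a h s q.1 q.2.1 q.2.2)) =
      ∑' q : ℤ × ℤ × ℤ,
        lennardJones (dist (barlowPos a h s m 0 0) (barlowPos a h s q.1 q.2.1 q.2.2)) := by
    set e : ℤ × ℤ × ℤ ≃ ℤ × ℤ × ℤ :=
      (Equiv.refl ℤ).prodCongr ((Equiv.addRight i).prodCongr (Equiv.addRight j)) with he
    rw [← e.tsum_eq]
    refine tsum_congr fun q => ?_
    simp only [he, Equiv.prodCongr_apply, Prod.map_fst, Prod.map_snd, Equiv.refl_apply,
      Equiv.coe_addRight, dist_barlowPos_eq_norm_layerVec, add_sub_cancel_right, sub_zero]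
  rw [hshift]
  have hF := summable_lennardJones_dist_barlowPos ha hh s (barlowPos a h s m 0 0)
  obtain ⟨G, hG⟩ : ∃ G : ℤ → ℝ, ∀ k, G k = ∑' ij : ℤ × ℤ,
      lennardJones (dist (barlowPos a h s m 0 0) (barlowPos a h s k ij.1 ij.2)) := ⟨_, fun _ => rfl⟩
  have hGs : Summable G := hF.prod.congr fun k => (hG k).symm
  have hG' : Summable fun t : ℤ => G (m + t) := hGs.comp_injective (Equiv.addLeft m).injective
  have h1 : Summable fun n : ℕ => G (m + ((n : ℤ) + 1)) :=
    hG'.comp_injective (i := fun n : ℕ => (n : ℤ) + 1)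
      fun n n' (hn : (n : ℤ) + 1 = (n' : ℤ) + 1) => by omega
  have h2 : Summable fun n : ℕ => G (m + -((n : ℤ) + 1)) :=
    hG'.comp_injective (i := fun n : ℕ => -((n : ℤ) + 1))
      fun n n' (hn : -((n : ℤ) + 1) = -((n' : ℤ) + 1)) => by omega
  have e1 : ∑' q : ℤ × ℤ × ℤ,
        lennardJones (dist (barlowPos a h s m 0 0) (barlowPos a h s q.1 q.2.1 q.2.2)) =
      (∑' n : ℕ, G (m + ((n : ℤ) + 1))) + G (m + 0) + ∑' n : ℕ, G (m + -((n : ℤ) + 1)) :=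
    ((hF.tsum_prod.trans (tsum_congr fun k => (hG k).symm)).trans
      ((Equiv.addLeft m).tsum_eq G).symm).trans
      (tsum_of_add_one_of_neg_add_one (f := fun t : ℤ => G (m + t)) h1 h2)
  have e0 : G (m + 0) = ∑' ij : ℤ × ℤ, (if ij = 0 then 0 else
      lennardJones (dist (barlowPos a h s m 0 0) (barlowPos a h s m ij.1 ij.2))) := by
    rw [add_zero, hG]
    refine tsum_congr fun ij => ?_
    split_ifs with hij
    · rw [hij, Prod.fst_zero, Prod.snd_zero, dist_self, lennardJones_zero]
    · rfl
  have eB : ∑' n : ℕ, G (m + ((n : ℤ) + 1)) = ∑' k : ℕ, ∑' ij : ℤ × ℤ, lennardJones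
      (dist (barlowPos a h s m 0 0) (barlowPos a h s (m + (k + 1 : ℕ)) ij.1 ij.2)) :=
    tsum_congr fun n => by
      have : m + ((n : ℤ) + 1) = m + ((n + 1 : ℕ) : ℤ) := by push_cast; ring
      rw [this, hG]
  have eC : ∑' n : ℕ, G (m + -((n : ℤ) + 1)) = ∑' k : ℕ, ∑' ij : ℤ × ℤ, lennardJones
      (dist (barlowPos a h s m 0 0) (barlowPos a h s (m - (k + 1 : ℕ)) ij.1 ij.2)) :=
    tsum_congr fun n => by
      have : m + -((n : ℤ) + 1) = m - ((n + 1 : ℕ) : ℤ) := by push_cast; ring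
      rw [this, hG]
  rw [e1, e0, eB, eC, barlowSiteEnergy]
  ring

/-! ## The root energy of a rotated exact stacking, re-rooted at an atom -/

/-- Sums over the image of a Barlow stacking (`a, h > 0`) under a map injective on it are sums over
the parameter lattice `ℤ³` (the parametrisation `barlowPos` is a bijection onto the stacking).
[folklore] -/
theorem summable_and_tsum_image_barlowStacking {a h : ℝ} (ha : 0 < a) (hh : 0 < h) (s : ℤ → ℤ)
    {Φ : EuclideanSpace ℝ (Fin 3) → EuclideanSpace ℝ (Fin 3)} (hΦ : Set.InjOn Φ (barlowStacking a h s))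
    (F : EuclideanSpace ℝ (Fin 3) → ℝ) :
    ((Summable fun t : ↥(Φ '' barlowStacking a h s) => F t) ↔
        Summable fun q : ℤ × ℤ × ℤ => F (Φ (barlowPos a h s q.1 q.2.1 q.2.2))) ∧
      ∑' t : ↥(Φ '' barlowStacking a h s), F t =
        ∑' q : ℤ × ℤ × ℤ, F (Φ (barlowPos a h s q.1 q.2.1 q.2.2)) := by
  set e₀ : ℤ × ℤ × ℤ → ↥(Φ '' barlowStacking a h s) := fun q =>
    ⟨Φ (barlowPos a h s q.1 q.2.1 q.2.2), Set.mem_image_of_mem Φ (barlowPos_mem _ _ _)⟩ with he₀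
  have hbij : Function.Bijective e₀ := by
    refine ⟨fun q q' hqq' => barlowPos_injective ha hh s
      (hΦ (barlowPos_mem _ _ _) (barlowPos_mem _ _ _) (congrArg Subtype.val hqq')), ?_⟩
    rintro ⟨_, _, ⟨k, i, j, rfl⟩, rfl⟩
    exact ⟨(k, i, j), rfl⟩
  set e := Equiv.ofBijective e₀ hbij with he
  exact ⟨(e.summable_iff (f := fun t : ↥(Φ '' barlowStacking a h s) => F t)).symm,
    (e.tsum_eq fun t : ↥(Φ '' barlowStacking a h s) => F t).symm⟩

/-- **Root energy identity.** For a linear isometry `A`, spacings `a, h > 0` and ANY word `s`, the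
configuration `count|(A '' barlowStacking a h s)` re-rooted (`Measure.map (· − y)`) at its atom
`y = A (barlowPos a h s k i j)` has root energy `½ ∫ V_LJ(‖z‖) = barlowSiteEnergy lennardJones a h s k`:
the re-rooted configuration is the counting measure of the image of the stacking under `z ↦ A z − A p`,
`‖A z − A p‖ = dist p z`, the sum is absolutely convergent, so the Bochner integral is the `tsum`, which
is the lattice sum seen from `p`. [folklore] -/
theorem rootEnergy_reroot_eq_barlowSiteEnergy {a h : ℝ} (ha : 0 < a) (hh : 0 < h) (s : ℤ → ℤ)
    (A : EuclideanSpace ℝ (Fin 3) ≃ₗᵢ[ℝ] EuclideanSpace ℝ (Fin 3)) (k i j : ℤ) :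
    (∫ z, lennardJones ‖z‖ ∂Measure.map (fun z => z - A (barlowPos a h s k i j))
        ((Measure.count : Measure (EuclideanSpace ℝ (Fin 3))).restrict (A '' barlowStacking a h s))) / 2 =
      barlowSiteEnergy lennardJones a h s k := by
  set p := barlowPos a h s k i j with hp
  have himg : (fun z => z - A p) '' (A '' barlowStacking a h s) =
      (fun z => A z - A p) '' barlowStacking a h s := Set.image_image _ _ _
  have hΦ : Set.InjOn (fun z => A z - A p) (barlowStacking a h s) := fun z _ z' _ hzz' =>
    A.injective (sub_left_injective hzz')
  rw [map_sub_count_restrict, himg]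
  set T := (fun z => A z - A p) '' barlowStacking a h s with hT
  have hcount : T.Countable := by
    refine (Set.Countable.mono ?_ (Set.countable_range
      fun q : ℤ × ℤ × ℤ => barlowPos a h s q.1 q.2.1 q.2.2)).image _
    rintro _ ⟨k', i', j', rfl⟩
    exact ⟨(k', i', j'), rfl⟩
  have hnorm : ∀ q : ℤ × ℤ × ℤ, ‖A (barlowPos a h s q.1 q.2.1 q.2.2) - A p‖ =
      dist p (barlowPos a h s q.1 q.2.1 q.2.2) := fun q => by
    rw [← map_sub, LinearIsometryEquiv.norm_map, dist_comm, dist_eq_norm]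
  obtain ⟨hiff, htsum⟩ :=
    summable_and_tsum_image_barlowStacking ha hh s hΦ fun z => lennardJones ‖z‖
  have hsum : Summable fun t : T => lennardJones ‖(t : EuclideanSpace ℝ (Fin 3))‖ := by
    refine hiff.2 ?_
    simp only [hnorm]
    exact summable_lennardJones_dist_barlowPos ha hh s p
  have hmeas : Measurable fun z : EuclideanSpace ℝ (Fin 3) => lennardJones ‖z‖ := by
    have hV : Measurable lennardJones := by
      show Measurable fun r : ℝ => (1 / 12) * (r⁻¹) ^ 12 - (1 / 6) * (r⁻¹) ^ 6
      exact ((measurable_inv.pow_const 12).const_mul _).sub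
        ((measurable_inv.pow_const 6).const_mul _)
    exact hV.comp measurable_norm
  have hint : Integrable (fun z : EuclideanSpace ℝ (Fin 3) => lennardJones ‖z‖)
      ((Measure.count : Measure (EuclideanSpace ℝ (Fin 3))).restrict T) := by
    refine ⟨hmeas.aestronglyMeasurable, ?_⟩
    rw [hasFiniteIntegral_iff_enorm, lintegral_countable _ hcount]
    simp only [Measure.count_singleton, mul_one]
    simp_rw [Real.enorm_eq_ofReal_abs]
    rw [← ENNReal.ofReal_tsum_of_nonneg (fun _ => abs_nonneg _) hsum.abs]
    exact ENNReal.ofReal_lt_top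
  have hI : ∫ z, lennardJones ‖z‖ ∂(Measure.count : Measure (EuclideanSpace ℝ (Fin 3))).restrict T =
      ∑' t : T, lennardJones ‖(t : EuclideanSpace ℝ (Fin 3))‖ := by
    rw [setIntegral_countable _ hcount hint]
    refine tsum_congr fun z => ?_
    rw [measureReal_def, Measure.count_singleton, ENNReal.toReal_one, one_smul]
  rw [hI, htsum]
  simp only [hnorm]
  rw [tsum_lennardJones_barlowPos_eq_two_mul_barlowSiteEnergy ha hh s k i j]
  ring

/-! ## The column (selection at a site); the level is not junk -/

/-- The column box for the two admissible spacings: `h₀` sits in `[39a₀/50, 17a₀/20]` by the minimiser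
enclosure `|a₀ − 0.97129|, |h₀ − 0.79294| ≤ 10⁻⁴`, and `a₀ √(2/3)` by `0.78 < √(2/3) < 0.85`. [folklore] -/
theorem column_box {a₀ h₀ : ℝ} (ha₁ : 189 / 200 ≤ a₀) (ha₂ : a₀ ≤ 199 / 200) (hh₁ : 77 / 100 ≤ h₀)
    (hh₂ : h₀ ≤ 163 / 200) (hmin : ∀ (a h : ℝ), 0 < a → 0 < h → hcpE a₀ h₀ ≤ hcpE a h)
    {h : ℝ} (hh : h = h₀ ∨ h = a₀ * Real.sqrt (2 / 3)) :
    0 < h ∧ 39 / 50 * a₀ ≤ h ∧ h ≤ 17 / 20 * a₀ := by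
  have ha0 : 0 < a₀ := by linarith
  rcases hh with rfl | rfl
  · obtain ⟨hA, hH⟩ := tube_minimiserEnclosure a₀ h ha₁ ha₂ hh₁ hh₂ hmin
    rw [abs_le] at hA hH
    exact ⟨by linarith, by linarith [hA.1, hA.2, hH.1, hH.2], by linarith [hA.1, hA.2, hH.1, hH.2]⟩
  · have h1 : (39 / 50 : ℝ) ≤ Real.sqrt (2 / 3) := Real.le_sqrt_of_sq_le (by norm_num)
    have h2 : Real.sqrt (2 / 3) ≤ 17 / 20 := Real.sqrt_le_iff.2 ⟨by norm_num, by norm_num⟩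
    have h3 : 0 < Real.sqrt (2 / 3) := Real.sqrt_pos.2 (by norm_num)
    exact ⟨mul_pos ha0 h3, by nlinarith, by nlinarith⟩

/-- **The column at a site; selection.** For `h ∈ {h₀, a₀ √(2/3)}`, a Hägg word `s` and a layer `m`,
the landed column gives `hcpE a₀ h₀ ≤ hcpE a₀ h ≤ hcpE a₀ h + ½ (J₃ − J₂)([s (m+1) = s m] +
[s (m−1) = s (m−2)]) ≤ barlowSiteEnergy … m` with `J₃ − J₂ > 0`; so the site energy is `≥ hcpE a₀ h₀`,
and if it is `≤ hcpE a₀ h₀` both indicators vanish (no cubic side at `m`) and `hcpE a₀ h = hcpE a₀ h₀`,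
i.e. `h = h₀` by uniqueness of the minimiser. [folklore] -/
theorem selection_at_site {a₀ h₀ : ℝ} (ha₁ : 189 / 200 ≤ a₀) (ha₂ : a₀ ≤ 199 / 200)
    (hh₁ : 77 / 100 ≤ h₀) (hh₂ : h₀ ≤ 163 / 200)
    (hmin : ∀ (a h : ℝ), 0 < a → 0 < h → hcpE a₀ h₀ ≤ hcpE a h)
    {h : ℝ} (hh : h = h₀ ∨ h = a₀ * Real.sqrt (2 / 3)) {s : ℤ → ℤ} (hs : IsHaggSeq s) (m : ℤ) :
    hcpE a₀ h₀ ≤ barlowSiteEnergy lennardJones a₀ h s m ∧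
      (barlowSiteEnergy lennardJones a₀ h s m ≤ hcpE a₀ h₀ →
        h = h₀ ∧ s (m + 1) ≠ s m ∧ s (m - 1) ≠ s (m - 2)) := by
  have ha0 : 0 < a₀ := by linarith
  have hh0 : 0 < h₀ := by linarith
  obtain ⟨hpos, hlo, hhi⟩ := column_box ha₁ ha₂ hh₁ hh₂ hmin hh
  obtain ⟨hJ, hcolumn⟩ :=
    SiteColumnLJ.stub_siteColumnLJ a₀ h (by linarith) (by linarith) hlo hhi
  have hc := hcolumn s hs m
  have hmin' := hmin a₀ h ha0 hpos
  set D := barlowCoupling lennardJones a₀ h 3 - barlowCoupling lennardJones a₀ h 2 with hD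
  set I₁ : ℝ := if s (m + 1) = s m then 1 else 0 with hI₁
  set I₂ : ℝ := if s (m - 1) = s (m - 2) then 1 else 0 with hI₂
  have hI₁0 : 0 ≤ I₁ := by rw [hI₁]; split_ifs <;> norm_num
  have hI₂0 : 0 ≤ I₂ := by rw [hI₂]; split_ifs <;> norm_num
  have hprod0 : 0 ≤ 1 / 2 * D * (I₁ + I₂) := mul_nonneg (by linarith) (by linarith)
  refine ⟨by linarith, fun hE => ?_⟩
  have hI : I₁ + I₂ ≤ 0 := by
    by_contra hlt
    have : 0 < 1 / 2 * D * (I₁ + I₂) := mul_pos (by linarith) (lt_of_not_ge hlt)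
    linarith
  have heq : hcpE a₀ h = hcpE a₀ h₀ := le_antisymm (by linarith) hmin'
  refine ⟨(tube_hcpE_unique_minimiser a₀ h₀ a₀ h ha0 hh0 ha0 hpos hmin heq).2, fun h1 => ?_,
    fun h1 => ?_⟩
  · have : I₁ = 1 := by rw [hI₁, if_pos h1]
    linarith
  · have : I₂ = 1 := by rw [hI₂, if_pos h1]
    linarith

/-- **The hcp level is negative**, quantitatively: a global minimiser of `hcpE` lies below the optimally
dilated hcp of layer ratio `1`, whose energy is `−S₃(1)²/(24 S₆(1)) < 0`. [folklore] -/
theorem hcpE_le_neg_of_isMin {a₀ h₀ : ℝ}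
    (hmin : ∀ (a h : ℝ), 0 < a → 0 < h → hcpE a₀ h₀ ≤ hcpE a h) :
    hcpE a₀ h₀ ≤ -(hcpSumS 3 1 ^ 2 / (24 * hcpSumS 6 1)) ∧ hcpE a₀ h₀ < 0 := by
  have h3 := hcpSumS_pos' (le_refl 3) one_pos
  have h6 := hcpSumS_pos' (by norm_num : 3 ≤ 6) one_pos
  have hq : 0 < hcpSumS 6 1 / hcpSumS 3 1 := div_pos h6 h3
  obtain ⟨b, hb0, hb6⟩ : ∃ b : ℝ, 0 < b ∧ b ^ 6 = hcpSumS 6 1 / hcpSumS 3 1 :=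
    ⟨(hcpSumS 6 1 / hcpSumS 3 1) ^ ((6 : ℕ) : ℝ)⁻¹, Real.rpow_pos_of_pos hq _,
      Real.rpow_inv_natCast_pow hq.le (by norm_num)⟩
  have key := hmin b (b * 1) hb0 (by rw [mul_one]; exact hb0)
  rw [hcpE_eq_hcpSumS hb0.ne' one_ne_zero, hcpPinC_dilation_value h3 h6 hb6] at key
  have hpos : 0 < hcpSumS 3 1 ^ 2 / (24 * hcpSumS 6 1) := by positivity
  exact ⟨key, by linarith⟩

/-- **A.s. floor plus mean ceiling at a negative level force integrability and a.s. equality.** If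
`c < 0`, `c ≤ f` a.s. and `∫ f dP ≤ c` for a probability measure `P`, then `f` is integrable (else its
Bochner integral would be `0 > c`) and `f = c` a.s. (`∫ (f − c) ≤ 0` with `f − c ≥ 0` a.s.).
[folklore] -/
theorem integrable_and_ae_eq_of_integral_le {Ω : Type*} [MeasurableSpace Ω] {P : Measure Ω}
    [IsProbabilityMeasure P] {f : Ω → ℝ} {c : ℝ} (hc : c < 0) (hge : ∀ᵐ ω ∂P, c ≤ f ω)
    (hint : ∫ ω, f ω ∂P ≤ c) : Integrable f P ∧ ∀ᵐ ω ∂P, f ω = c := by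
  have hf : Integrable f P := by
    by_contra hnot
    rw [integral_undef hnot] at hint
    linarith
  have hg : 0 ≤ᵐ[P] fun ω => f ω - c := hge.mono fun ω hω => sub_nonneg.2 hω
  have hgi : Integrable (fun ω => f ω - c) P := hf.sub (integrable_const c)
  have h0 : ∫ ω, (f ω - c) ∂P = 0 := by
    refine le_antisymm ?_ (integral_nonneg_of_ae hg)
    rw [integral_sub hf (integrable_const c), integral_const, smul_eq_mul, probReal_univ, one_mul]
    linarith
  refine ⟨hf, ?_⟩
  filter_upwards [(integral_eq_zero_iff_of_nonneg_ae hg hgi).1 h0] with ω hω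
  have h1 : f ω - c = 0 := hω
  linarith

/-! ## Per-sample conclusion and the stub -/

/-- **From "site energy `≤ hcpE a₀ h₀` in every layer" to hcp.** If every layer `k` of the Hägg word
`s` has `barlowSiteEnergy lennardJones a₀ h₀ s k ≤ hcpE a₀ h₀`, then no layer is cubic
(`selection_at_site`), so `s = ± alternatingHagg` and `count|(A '' barlowStacking a₀ h₀ s)` is
`count|(A' '' hcpStacking a₀ h₀)` with `A' = A` or `A ∘ (−id)`. [folklore] -/
theorem exists_eq_hcp_of_forall_siteEnergy_le {a₀ h₀ : ℝ} (ha₁ : 189 / 200 ≤ a₀)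
    (ha₂ : a₀ ≤ 199 / 200) (hh₁ : 77 / 100 ≤ h₀) (hh₂ : h₀ ≤ 163 / 200)
    (hmin : ∀ (a h : ℝ), 0 < a → 0 < h → hcpE a₀ h₀ ≤ hcpE a h)
    (A : EuclideanSpace ℝ (Fin 3) ≃ₗᵢ[ℝ] EuclideanSpace ℝ (Fin 3)) {s : ℤ → ℤ} (hs : IsHaggSeq s)
    (hall : ∀ k : ℤ, barlowSiteEnergy lennardJones a₀ h₀ s k ≤ hcpE a₀ h₀) :
    ∃ A' : EuclideanSpace ℝ (Fin 3) ≃ₗᵢ[ℝ] EuclideanSpace ℝ (Fin 3),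
      (Measure.count : Measure (EuclideanSpace ℝ (Fin 3))).restrict (A '' barlowStacking a₀ h₀ s) =
        (Measure.count : Measure (EuclideanSpace ℝ (Fin 3))).restrict (A' '' hcpStacking a₀ h₀) := by
  have hk : ∀ k : ℤ, s k = -s (k - 1) := by
    intro k
    have hne := ((selection_at_site ha₁ ha₂ hh₁ hh₂ hmin (Or.inl rfl) hs (k - 1)).2 (hall _)).2.1
    rw [sub_add_cancel] at hne
    rcases hs k with h2 | h2 <;> rcases hs (k - 1) with h3 | h3 <;> rw [h2, h3] at hne ⊢ <;> omega
  rcases eq_alternating_or_neg_of_forall hs hk with halt | halt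
  · obtain rfl : s = alternatingHagg := funext halt
    exact ⟨A, rfl⟩
  · obtain rfl : s = fun m => -alternatingHagg m := funext halt
    refine ⟨(LinearIsometryEquiv.neg ℝ).trans A, ?_⟩
    rw [← (bijOn_neg_hcpStacking a₀ h₀).image_eq, hcpStacking, LinearIsometryEquiv.coe_trans,
      Set.image_comp, LinearIsometryEquiv.coe_neg]

/-- **X3, SELECTION AT EXACT GEOMETRY** (anchor `stub_exactSelectionLawB` = the statement of the line's
stub `stub_exactSelectionLaw`, landed a second time, in this import cone; the first landing is
`…ExactSelectionLaw.stub_exactSelectionLaw`).  For the relaxed reference `(a₀, h₀)` (box + global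
`hcpE`-minimality), a point-stationary probability law on rooted `δ`-hard-core
configurations which is a.s. the counting measure of a rotated exact stacking `A '' barlowStacking a₀ h s`
with `h ∈ {h₀, a₀ √(2/3)}`, `s` a Hägg word, and whose mean root energy is `≤ hcpE a₀ h₀`, is a.s. a
rotated `hcpStacking a₀ h₀`: the root energy of a sample is `barlowSiteEnergy … s 0 ≥ hcpE a₀ h₀`; the
level `hcpE a₀ h₀ < 0` is not junk, so the mean ceiling forces a.s. equality; Aldous–Lyons moves the
equality to every atom (hard-core configurations are locally finite), where it is the site energy of the
atom's layer, so `h = h₀`, no layer is cubic, `s = ± alternatingHagg`, the sign a point reflection.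
[folklore] -/
theorem stub_exactSelectionLawB :
    ∀ (a₀ h₀ : ℝ), 189 / 200 ≤ a₀ → a₀ ≤ 199 / 200 → 77 / 100 ≤ h₀ → h₀ ≤ 163 / 200 →
      (∀ a h : ℝ, 0 < a → 0 < h →
        Summit.AtomisticToContinuum.Crystallization.Theorems.PalmUnimodularRigidity.LayeredLawsSelectHcp.hcpE a₀ h₀ ≤
          Summit.AtomisticToContinuum.Crystallization.Theorems.PalmUnimodularRigidity.LayeredLawsSelectHcp.hcpE a h) →
      ∀ δ : ℝ, 0 < δ → ∀ P : Measure (Measure (EuclideanSpace ℝ (Fin 3))), IsProbabilityMeasure P →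
        (∀ᵐ μ ∂P, IsRootedHardCore δ μ) → IsPointStationaryLaw P →
        (∫ μ, (∫ y, lennardJones ‖y‖ ∂μ) / 2 ∂P) ≤
          Summit.AtomisticToContinuum.Crystallization.Theorems.PalmUnimodularRigidity.LayeredLawsSelectHcp.hcpE a₀ h₀ →
        (∀ᵐ μ ∂P, ∃ A : EuclideanSpace ℝ (Fin 3) ≃ₗᵢ[ℝ] EuclideanSpace ℝ (Fin 3), ∃ h : ℝ,
          (h = h₀ ∨ h = a₀ * Real.sqrt (2 / 3)) ∧ ∃ s : ℤ → ℤ, IsHaggSeq s ∧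
            μ = (Measure.count : Measure (EuclideanSpace ℝ (Fin 3))).restrict (A '' barlowStacking a₀ h s)) →
        ∀ᵐ μ ∂P, ∃ A : EuclideanSpace ℝ (Fin 3) ≃ₗᵢ[ℝ] EuclideanSpace ℝ (Fin 3),
          μ = (Measure.count : Measure (EuclideanSpace ℝ (Fin 3))).restrict (A '' hcpStacking a₀ h₀) := by
  intro a₀ h₀ ha₁ ha₂ hh₁ hh₂ hmin δ hδ P hP hHC hstat hEn hcar
  have ha0 : 0 < a₀ := by linarith
  -- the root energy of a sample: the root `0 = A (barlowPos a₀ h s 0 0 0)` is an atom of layer `0`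
  have hroot : ∀ (A : EuclideanSpace ℝ (Fin 3) ≃ₗᵢ[ℝ] EuclideanSpace ℝ (Fin 3)) {h : ℝ}, 0 < h →
      ∀ s : ℤ → ℤ, (∫ z, lennardJones ‖z‖ ∂(Measure.count : Measure (EuclideanSpace ℝ (Fin 3))).restrict
        (A '' barlowStacking a₀ h s)) / 2 = barlowSiteEnergy lennardJones a₀ h s 0 := by
    intro A h hpos s
    have h1 := rootEnergy_reroot_eq_barlowSiteEnergy ha0 hpos s A 0 0 0
    have h0 : barlowPos a₀ h s 0 0 0 = 0 := by simp [barlowPos]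
    rw [h0, map_zero] at h1
    simpa only [sub_zero, Measure.map_id'] using h1
  have hge : ∀ᵐ μ ∂P, hcpE a₀ h₀ ≤ (∫ y, lennardJones ‖y‖ ∂μ) / 2 := by
    filter_upwards [hcar] with μ hμ
    obtain ⟨A, h, hh, s, hs, rfl⟩ := hμ
    rw [hroot A (column_box ha₁ ha₂ hh₁ hh₂ hmin hh).1 s]
    exact (selection_at_site ha₁ ha₂ hh₁ hh₂ hmin hh hs 0).1
  have hae : ∀ᵐ μ ∂P, (∫ y, lennardJones ‖y‖ ∂μ) / 2 = hcpE a₀ h₀ :=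
    (integrable_and_ae_eq_of_integral_le (hcpE_le_neg_of_isMin hmin).2 hge hEn).2
  have hlf : ∀ᵐ μ ∂P, ∀ n : ℕ, μ ((fun z : EuclideanSpace ℝ (Fin 3) => ⌊‖z‖⌋₊) ⁻¹' {n}) < ⊤ := by
    filter_upwards [hHC] with μ hμ
    obtain ⟨S, -, hsep, rfl⟩ := hμ
    exact fun n => PalmUnimodularRigidity.count_restrict_floorNorm_preimage_lt_top hδ hsep n
  have hevery : ∀ᵐ μ ∂P, ∀ y : EuclideanSpace ℝ (Fin 3), μ {y} ≠ 0 →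
      (∫ z, lennardJones ‖z‖ ∂Measure.map (fun z => z - y) μ) / 2 = hcpE a₀ h₀ :=
    PalmUnimodularRigidity.ae_forall_map_sub_of_ae
      (p := fun ν => (∫ z, lennardJones ‖z‖ ∂ν) / 2 = hcpE a₀ h₀) hstat hlf hae
  filter_upwards [hcar, hae, hevery] with μ hrep hr hall
  obtain ⟨A, h, hh, s, hs, rfl⟩ := hrep
  rw [hroot A (column_box ha₁ ha₂ hh₁ hh₂ hmin hh).1 s] at hr
  obtain rfl : h = h₀ := ((selection_at_site ha₁ ha₂ hh₁ hh₂ hmin hh hs 0).2 hr.le).1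
  -- at the atom `A (barlowPos a₀ h s k 0 0)` the root energy is the site energy of layer `k`
  refine exists_eq_hcp_of_forall_siteEnergy_le ha₁ ha₂ hh₁ hh₂ hmin A hs fun k => ?_
  have h1 := hall _ ((count_restrict_singleton_ne_zero_iff _ _).2
    (Set.mem_image_of_mem A (barlowPos_mem k 0 0)))
  rw [rootEnergy_reroot_eq_barlowSiteEnergy ha0 (by linarith) s A k 0 0] at h1
  exact h1.le

end Summit.AtomisticToContinuum.Crystallization.Theorems.PalmGoodLaw.ExactSelectionLawB

end
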